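import Summits.CriticalPhenomena.PercolationContinuityZ3.Theorems.PercNearOneGluingNoHeavyLowerTailTwoLevelPackingCardSubTwoTransfer
import HarnessLib

/-!
# `NoHeavyLowerTail` (stmt-CriticalPhenomena-4575) — two-level packing at level `|A| − 2`: covering pieces

Support file (lemma factory #8 `prim-lf-8`, gen 5; `--supports stmt-CriticalPhenomena-4575`).  No definitions, no named
facts, no sorries.  Notation of `…TwoLevelPackingCardSubTwoTools.lean` (`F = {o ↮ c}`, `L = {1 ≤ N ≤ k−2}`, `R_c`, `D_c`, `Q_c`,
`H_c = D_c ∩ Q_c`, `U = {o ↔ A∖c}`).  Three elementary pieces of the level-`(|A|−2)` STCS2/QP proof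
(`…TwoLevelPackingCardSubTwo.lean`):

* `lower_piece_le` — `μ(F ∩ L ∩ R_c) + μ(D_c ∩ U ∩ Q_c) ≤ μ(F ∩ {1 ≤ N} ∩ R_c)` (the good piece is attached, light, `c`-free
  and misses `L`);
* `light_split` — for `d ≠ c`, `μ(R_d) = (μ(R_c) − μ(H_c)) + μ(H_d)` (all relays share the fragmented mass);
* `cover_le` — `μ(F ∩ L) ≤ μ(F ∩ L ∩ R_c) + Σ_{d ≠ c} μ({o↔d} ∩ H_d)` (the lead's cover of `L ∖ R_c`).
-/

noncomputable section

namespace Summit.CriticalPhenomena.PercolationContinuityZ3.Theorems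

open MeasureTheory Set Filter Literature.Probability.LatticeModels Literature.Probability.Percolation
open scoped Classical BigOperators Topology

namespace TwoLevelPackingCardSubTwo

variable {n : ℕ}

/-- **The good piece lies in `F ∩ {1 ≤ N} ∩ R_c` and misses `L`**:
`μ(F ∩ L ∩ R_c) + μ(D_c ∩ (U ∩ Q_c)) ≤ μ(F ∩ {1 ≤ N} ∩ R_c)`. [folklore] -/
theorem lower_piece_le (w : Sym2 (Fin n) → unitInterval) (A : Finset (Fin n)) (o c : Fin n) (hc : c ∈ A)
    (hk : 3 ≤ A.card) :
    (prodBernoulli w).real ((openConn o c : Set (BondConfig (Fin n)))ᶜ ∩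
          {ω | 1 ≤ (A.filter fun x => ω ∈ openConn o x).card ∧
            (A.filter fun x => ω ∈ openConn o x).card ≤ A.card - 2} ∩
          {ω | (A.filter fun x => ω ∈ openConn c x).card ≤ A.card - 2}) +
      (prodBernoulli w).real ({ω : BondConfig (Fin n) | ∀ t ∈ A.erase c, ω ∉ openConn c t} ∩
        ((⋃ b ∈ A.erase c, openConn o b) ∩
          {ω | ∀ t ∈ (↑(A.erase c) : Set (Fin n)), ∀ t' ∈ (↑(A.erase c) : Set (Fin n)), ω ∈ openConn t t'})) ≤
    (prodBernoulli w).real ((openConn o c : Set (BondConfig (Fin n)))ᶜ ∩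
        {ω | 1 ≤ (A.filter fun x => ω ∈ openConn o x).card ∧
          (A.filter fun x => ω ∈ openConn c x).card ≤ A.card - 2}) := by
  set μ := prodBernoulli w with hμ
  have hmeas : ∀ s : Set (BondConfig (Fin n)), MeasurableSet s := fun _ => MeasurableSet.of_discrete
  have hgood : ∀ ω : BondConfig (Fin n), ω ∈ ({ω : BondConfig (Fin n) | ∀ t ∈ A.erase c, ω ∉ openConn c t} ∩
      ((⋃ b ∈ A.erase c, openConn o b) ∩
        {ω | ∀ t ∈ (↑(A.erase c) : Set (Fin n)), ∀ t' ∈ (↑(A.erase c) : Set (Fin n)), ω ∈ openConn t t'})) →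
      ω ∉ (openConn o c : Set (BondConfig (Fin n))) ∧
        (A.filter fun x => ω ∈ openConn c x).card ≤ A.card - 2 ∧
        ¬ (A.filter fun x => ω ∈ openConn o x).card ≤ A.card - 2 ∧
        1 ≤ (A.filter fun x => ω ∈ openConn o x).card := by
    rintro ω ⟨hD, hU, hQ⟩
    rw [Set.mem_iUnion₂] at hU
    obtain ⟨b, hb, hob⟩ := hU
    refine ⟨fun hoc => hD b hb ?_, ?_, ?_, Finset.card_pos.2 ⟨b, Finset.mem_filter.2 ⟨Finset.mem_of_mem_erase hb, hob⟩⟩⟩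
    · exact ((show (openGraph ω).Reachable o c from hoc).symm.trans (show (openGraph ω).Reachable o b from hob) :
        (openGraph ω).Reachable c b)
    · have hsub : (A.filter fun x => ω ∈ openConn c x) ⊆ {c} := by
        intro x hx
        obtain ⟨hxA, hcx⟩ := Finset.mem_filter.1 hx
        rw [Finset.mem_singleton]
        by_contra hxc
        exact hD x (Finset.mem_erase.2 ⟨hxc, hxA⟩) hcx
      exact (Finset.card_le_card hsub).trans (by simp; omega)
    · have hsub : A.erase c ⊆ A.filter fun x => ω ∈ openConn o x := by
        intro t ht
        refine Finset.mem_filter.2 ⟨Finset.mem_of_mem_erase ht, ?_⟩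
        have hbt : (openGraph ω).Reachable b t := hQ b hb t ht
        exact ((show (openGraph ω).Reachable o b from hob).trans hbt : (openGraph ω).Reachable o t)
      have := Finset.card_le_card hsub
      rw [Finset.card_erase_of_mem hc] at this
      omega
  have hdisj : Disjoint ((openConn o c : Set (BondConfig (Fin n)))ᶜ ∩
          {ω | 1 ≤ (A.filter fun x => ω ∈ openConn o x).card ∧
            (A.filter fun x => ω ∈ openConn o x).card ≤ A.card - 2} ∩
          {ω | (A.filter fun x => ω ∈ openConn c x).card ≤ A.card - 2})
      ({ω : BondConfig (Fin n) | ∀ t ∈ A.erase c, ω ∉ openConn c t} ∩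
        ((⋃ b ∈ A.erase c, openConn o b) ∩
          {ω | ∀ t ∈ (↑(A.erase c) : Set (Fin n)), ∀ t' ∈ (↑(A.erase c) : Set (Fin n)), ω ∈ openConn t t'})) :=
    Set.disjoint_left.2 fun ω hω hω' => (hgood ω hω').2.2.1 hω.1.2.2
  rw [← measureReal_union hdisj (hmeas _)]
  refine measureReal_mono ?_ (measure_ne_top μ _)
  rintro ω (⟨⟨hF, h1, -⟩, hR⟩ | hω')
  · exact ⟨hF, h1, hR⟩
  · exact ⟨(hgood ω hω').1, (hgood ω hω').2.2.2, (hgood ω hω').2.1⟩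

/-- **Lightness splits at level `k − 2`**: for `d ≠ c`, `μ(R_d) = (μ(R_c) − μ(H_c)) + μ(H_d)` — all relays share the
fragmented mass `m = μ(R_c ∖ H_c)`. [folklore] -/
theorem light_split (w : Sym2 (Fin n) → unitInterval) (A : Finset (Fin n)) (c : Fin n) (hc : c ∈ A) (hk : 3 ≤ A.card)
    {d : Fin n} (hd : d ∈ A.erase c) :
    (prodBernoulli w).real {ω : BondConfig (Fin n) | (A.filter fun x => ω ∈ openConn d x).card ≤ A.card - 2} =
      ((prodBernoulli w).real {ω : BondConfig (Fin n) | (A.filter fun x => ω ∈ openConn c x).card ≤ A.card - 2} -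
        (prodBernoulli w).real ({ω : BondConfig (Fin n) | ∀ t ∈ A.erase c, ω ∉ openConn c t} ∩
          {ω | ∀ t ∈ (↑(A.erase c) : Set (Fin n)), ∀ t' ∈ (↑(A.erase c) : Set (Fin n)), ω ∈ openConn t t'})) +
      (prodBernoulli w).real ({ω : BondConfig (Fin n) | ∀ t ∈ A.erase d, ω ∉ openConn d t} ∩
          {ω | ∀ t ∈ (↑(A.erase d) : Set (Fin n)), ∀ t' ∈ (↑(A.erase d) : Set (Fin n)), ω ∈ openConn t t'}) := by
  set μ := prodBernoulli w with hμ
  set R : Fin n → Set (BondConfig (Fin n)) := fun a =>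
    {ω | (A.filter fun x => ω ∈ openConn a x).card ≤ A.card - 2} with hR
  have hmeas : ∀ s : Set (BondConfig (Fin n)), MeasurableSet s := fun _ => MeasurableSet.of_discrete
  have hdA : d ∈ A := Finset.mem_of_mem_erase hd
  have hdc : d ≠ c := (Finset.mem_erase.1 hd).1
  have h1 : μ.real (R c) = μ.real (R c ∩ R d) + μ.real (R c \ R d) :=
    (measureReal_inter_add_sdiff (μ := μ) (s := R c) (t := R d) (hmeas _)).symm
  have h2 : μ.real (R d) = μ.real (R d ∩ R c) + μ.real (R d \ R c) :=
    (measureReal_inter_add_sdiff (μ := μ) (s := R d) (t := R c) (hmeas _)).symm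
  rw [AttachedChampionCardSubTwo.sdiff_eq_partition A hdA hc hdc hk] at h1
  rw [AttachedChampionCardSubTwo.sdiff_eq_partition A hc hdA (Ne.symm hdc) hk, Set.inter_comm (R d) (R c)] at h2
  change μ.real (R d) = μ.real (R c) - _ + _
  rw [h2, h1]; ring

/-- **Cover**: `μ(F ∩ L) ≤ μ(F ∩ L ∩ R_c) + Σ_{d ≠ c} μ({o↔d} ∩ H_d)` (the lead's level-`(k−2)` cover of `L ∖ R_c`). [folklore] -/
theorem cover_le (w : Sym2 (Fin n) → unitInterval) (A : Finset (Fin n)) (o c : Fin n) (hc : c ∈ A) :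
    (prodBernoulli w).real ((openConn o c : Set (BondConfig (Fin n)))ᶜ ∩
        {ω | 1 ≤ (A.filter fun x => ω ∈ openConn o x).card ∧
          (A.filter fun x => ω ∈ openConn o x).card ≤ A.card - 2}) ≤
      (prodBernoulli w).real ((openConn o c : Set (BondConfig (Fin n)))ᶜ ∩
          {ω | 1 ≤ (A.filter fun x => ω ∈ openConn o x).card ∧
            (A.filter fun x => ω ∈ openConn o x).card ≤ A.card - 2} ∩
          {ω | (A.filter fun x => ω ∈ openConn c x).card ≤ A.card - 2}) +
      ∑ d ∈ A.erase c, (prodBernoulli w).real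
        (openConn o d ∩ {ω : BondConfig (Fin n) | ∀ t ∈ A.erase d, ω ∉ openConn d t} ∩
          {ω | ∀ t ∈ (↑(A.erase d) : Set (Fin n)), ∀ t' ∈ (↑(A.erase d) : Set (Fin n)), ω ∈ openConn t t'}) := by
  set μ := prodBernoulli w with hμ
  set F : Set (BondConfig (Fin n)) := (openConn o c : Set (BondConfig (Fin n)))ᶜ with hF
  set L : Set (BondConfig (Fin n)) := {ω | 1 ≤ (A.filter fun x => ω ∈ openConn o x).card ∧
    (A.filter fun x => ω ∈ openConn o x).card ≤ A.card - 2} with hL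
  set Rc : Set (BondConfig (Fin n)) := {ω | (A.filter fun x => ω ∈ openConn c x).card ≤ A.card - 2} with hRc
  have hsub : F ∩ L ⊆ (F ∩ L ∩ Rc) ∪ (L \ Rc) := by
    rintro ω ⟨hf, hl⟩
    by_cases hr : ω ∈ Rc
    · exact Or.inl ⟨⟨hf, hl⟩, hr⟩
    · exact Or.inr ⟨hl, hr⟩
  have hLR := (measureReal_mono (AttachedChampionCardSubTwo.cover_sdiff_subset A o c hc) (measure_ne_top μ _)).trans
    (measureReal_biUnion_finset_le (μ := μ) (A.erase c) fun d =>
      (openConn o d ∩ {ω : BondConfig (Fin n) | ∀ t ∈ A.erase d, ω ∉ openConn d t} ∩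
        {ω | ∀ t ∈ (↑(A.erase d) : Set (Fin n)), ∀ t' ∈ (↑(A.erase d) : Set (Fin n)), ω ∈ openConn t t'}))
  calc μ.real (F ∩ L) ≤ μ.real ((F ∩ L ∩ Rc) ∪ (L \ Rc)) := measureReal_mono hsub (measure_ne_top μ _)
    _ ≤ μ.real (F ∩ L ∩ Rc) + μ.real (L \ Rc) := measureReal_union_le _ _
    _ ≤ _ := by linarith

end TwoLevelPackingCardSubTwo

end Summit.CriticalPhenomena.PercolationContinuityZ3.Theorems

end
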